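import Mathlib
import HarnessLib
import Literature.MathematicalPhysics.StatisticalMechanics.ActivityExtension

/-!
# The renormalisation step reads the relevant data off connected polymers: `B_k`, `H̃_k` and the
# round trip `mulExt ∘ restrictConn` for factorising activities ([ABKM19] Ch. 6.2–6.3)

Bookkeeping for the representation of the flow (the trajectory of the fine-tuning engine carries
`y_k ∈ activitySpace P k`, the renormalisation map consumes `mulExt y_k`):

* `opB_mulExt`, `nextH_mulExt` — `B_k` and `H̃_k = nextH` only read the activity at the connected
  reference block `B₀`, so `opB D (mulExt K) = opB D K`, `nextH D H (mulExt K) = nextH D H K`;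
* **`mulExt_restrictConn_eq_of_factorises`** — for an activity `K` factorising on scale `s` with
  `K(∅) = 1` (e.g. `K_{k+1} = nextKStep D H K`, `factorises_nextKStep`, `nextKStep_empty`), the extension
  of its restriction to connected polymers is `K` on every `s`-polymer: `mulExt (restrictConn s K) X = K X`.

Everything is proved; no named fact.

## References
* S. Adams, S. Buchholz, R. Kotecký, S. Müller, arXiv:1910.13564, Ch. 6.2 (6.35), Definition 6.5
  (6.15)–(6.16), Theorem 6.8 (6.57) [AdamsBuchholzKoteckyMuller2019].
-/

noncomputable section

namespace Literature.MathematicalPhysics.StatisticalMechanics.GradientRG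

open scoped BigOperators Classical
open Finset
open Literature.MathematicalPhysics.StatisticalMechanics.TorusPolymer (IsPolymer Separated)
open Literature.Barriers.CriticalPhenomena.LongRangePhi4.Polymer (IsConn components eq_biUnion_components)

variable {d M : ℕ} [NeZero M]

/-- **`B_k` only reads `K(B₀)`**: `opB D (mulExt K) = opB D K` when the reference block is connected.
[cite: AdamsBuchholzKoteckyMuller2019, Theorem 6.8 (6.57)] -/
theorem opB_mulExt (D : StepData d M) (hB₀ : IsConn D.B₀)
    (K : Finset (Fin d → ZMod M) → ((Fin d → ZMod M) → ℝ) → ℂ) : opB D (mulExt K) = opB D K := by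
  unfold opB; rw [mulExt_of_isConn hB₀]

/-- **`H̃_k` only reads `K(B₀)`**: `nextH D H (mulExt K) = nextH D H K` when the reference block is
connected. [cite: AdamsBuchholzKoteckyMuller2019, Definition 6.5 (6.16)] -/
theorem nextH_mulExt (D : StepData d M) (hB₀ : IsConn D.B₀) (H : RelevantHamiltonian ℂ d)
    (K : Finset (Fin d → ZMod M) → ((Fin d → ZMod M) → ℝ) → ℂ) : nextH D H (mulExt K) = nextH D H K := by
  unfold nextH; rw [mulExt_of_isConn hB₀]

/-- **Round trip**: for `K` factorising on scale `s` with `K(∅) = 1` (odd torus `M = s·t`),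
`mulExt (restrictConn s K) X = K X` on every `s`-polymer `X` (both sides are the product of `K` over
the connected components of `X`). [cite: AdamsBuchholzKoteckyMuller2019, Lemma 6.4 (5) (6.35)] -/
theorem mulExt_restrictConn_eq_of_factorises {s t : ℕ} (hMt : M = s * t) (hs : Odd s) (ht : Odd t)
    {K : Finset (Fin d → ZMod M) → ((Fin d → ZMod M) → ℝ) → ℂ} (hK : Factorises s K)
    (hK0 : ∀ φ, K ∅ φ = 1) {X : Finset (Fin d → ZMod M)} (hX : IsPolymer s X) :
    mulExt (restrictConn s K) X = K X := by
  have hMo : Odd M := by rw [hMt]; exact hs.mul ht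
  have hpoly : ∀ Y ∈ components X, IsPolymer s Y := fun Y hY =>
    (TorusPolymer.IsPolymer.of_mem_components hMo hs hX hY).1
  have hsep := TorusPolymer.pairwise_separated_components hMt hs ht hX
  funext φ
  rw [mulExt_apply]
  conv_rhs => rw [eq_biUnion_components X, eq_prod_of_factorises hK hK0 _ hpoly hsep φ]
  refine prod_congr rfl fun Y hY => ?_
  obtain ⟨hYp, hYc⟩ := TorusPolymer.IsPolymer.of_mem_components hMo hs hX hY
  rw [restrictConn_of_conn hYp hYc]

end Literature.MathematicalPhysics.StatisticalMechanics.GradientRG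

end
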